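import Literature.Topology.FourManifolds.BordismFourProjectivePlane
import Literature.Topology.FourManifolds.ComplexProjectiveSpaceOrientationProofs
import Literature.Topology.FourManifolds.IntersectionLatticeOrientationProofs
import Literature.AlgebraicTopology.SingularHomology.RestrictionAcyclicComplement
import Literature.AlgebraicTopology.SingularHomology.PoincareDualityCorollaries
import Literature.AlgebraicTopology.SingularHomology.OrientationProofs
import Literature.AlgebraicTopology.SingularHomology.CohomologyOfPoint
import Literature.AlgebraicTopology.SingularHomology.UniversalCoefficientsField
import Literature.AlgebraicTopology.Homotopy.ENRTheorem
import Literature.Geometry.Manifold.TopologicalEmbedding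
import Mathlib.Analysis.Convex.Contractible
import HarnessLib

/-!
# The complex cohomology of `ℂℙᴺ`: `b₂ₖ = 1` and non-degeneracy of the cup product

Topic `Literature/Topology/FourManifolds` (the tree's smooth model `ComplexProjectiveSpace N` of
`ℂℙᴺ`). The classical computation `H*(ℂℙᴺ; ℤ) = ℤ[h]/(h^{N+1})`, `|h| = 2` (A. Hatcher,
*Algebraic Topology* (2002), Thm. 3.19; J. Milnor, J. Stasheff, *Characteristic Classes* (1974),
Thm. 14.4), in the form needed over `ℂ` by the Lefschetz arguments of
`Literature/AlgebraicGeometry/HodgeTheory` (degrees of hypersurfaces, `hᵖ ≠ 0`):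

* `finrank_singularCohomology_two_mul_eq_one` — **`dim_ℂ H²ᵏ(ℂℙᴺ; ℂ) = 1` for `k ≤ N`**;
* `cupProduct_ne_zero_of_add_le` — **the cup product of non-zero classes of degrees `2p`, `2q`,
  `p + q ≤ N`, is non-zero** (so `H*(ℂℙᴺ; ℂ)` is the truncated polynomial ring on any generator of
  `H²`).

Proof exactly as Hatcher's proof of Thm. 3.19 (p. 250: "by induction on `n` … the inclusion
`ℂPⁿ⁻¹ ↪ ℂPⁿ` induces an isomorphism on `Hⁱ` for `i ≤ 2n − 2` … Poincaré duality [the cup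
product pairing is nonsingular over a field, Prop. 3.38]"), with the tree's PROVED ingredients:

* the restriction to the hyperplane `ℂℙⁿ ≅ {z₀ = 0} ⊂ ℂℙⁿ⁺¹` (`hyperplaneEmb`, file
  `BordismFourProjectivePlane`) is bijective on `Hᵏ` for `k ≤ 2n`
  (`bijective_map_hyperplaneEmb`): its complement is the affine chart `≅ ℝ²⁽ⁿ⁺¹⁾`, contractible,
  so this is the duality statement `singularCohomology.map_subtypeVal_{surjective,injective}_of_isZero_compl`
  (`…RestrictionAcyclicComplement`, Čech–Poincaré–Lefschetz duality on the closed oriented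
  `2(n+1)`-manifold `ℂℙⁿ⁺¹`, oriented by `isOrientable_complexProjectiveSpace_holds` and
  `isOrientableOver_int_of_isOrientable_holds`), the hyperplane being taut
  (`Cech.RetractionNhds.nonempty_of_locallyContractibleSpace`, ENR theorem);
* the top degree `H²ᴺ(ℂℙᴺ; ℂ) ≅ ℂ` (`nonempty_singularCohomology_top_equiv_holds`) and
  `H⁰ ≅ ℂ · 1` (`singularCohomologyZeroEquiv`);
* Hatcher Prop. 3.38 over a field (`isPerfPair_cupPairing_of_field_holds`).

Everything here is proved; no named facts.

## References

* A. Hatcher, *Algebraic Topology*, CUP 2002, Thm. 3.19 and its proof p. 250, Prop. 3.38.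
  [HatcherAT2002]
* J. Milnor, J. Stasheff, *Characteristic Classes*, Princeton 1974, Thm. 14.4. [MilnorStasheff1974]
-/

noncomputable section

open CategoryTheory Set Function Topology
open Literature.AlgebraicTopology.SingularHomology Literature.AlgebraicTopology.Homotopy

namespace Literature.Topology.FourManifolds

namespace ComplexProjectiveSpace

variable {n : ℕ}

/-! ### The hyperplane `ℂℙⁿ ≅ {z_i = 0} ⊂ ℂℙⁿ⁺¹` and its contractible complement -/

/-- The hyperplane embedding is injective (the projection from the centre is a left inverse).
[folklore] -/
theorem hyperplaneEmb_injective (i : Fin (n + 1 + 1)) : Injective (hyperplaneEmb (n := n) i) :=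
  (LeftInverse.injective (g := dropAt i) (dropAt_hyperplaneEmb i))

/-- The hyperplane embedding `ℂℙⁿ ↪ ℂℙⁿ⁺¹` is a closed embedding (injective, continuous, compact
source, Hausdorff target). [folklore] -/
theorem isClosedEmbedding_hyperplaneEmb (i : Fin (n + 1 + 1)) :
    IsClosedEmbedding (hyperplaneEmb (n := n) i) :=
  (continuous_hyperplaneEmb i).isClosedEmbedding (hyperplaneEmb_injective i)

/-- The image of the hyperplane embedding is the hyperplane `{z_i = 0}`. [folklore] -/
theorem range_hyperplaneEmb (i : Fin (n + 1 + 1)) :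
    range (hyperplaneEmb (n := n) i) = {p | ¬ CoordNeZero i p} := by
  ext p
  constructor
  · rintro ⟨q, rfl⟩
    induction q using ind with
    | h w => simp [coe_padAt]
  · intro hp
    induction p using ind with
    | h v =>
      have hv : (v : Fin (n + 1 + 1) → ℂ) i = 0 := by simpa using hp
      have hw : Fin.removeNth i (v : Fin (n + 1 + 1) → ℂ) ≠ 0 := by
        intro h0
        apply v.2
        rw [← Fin.insertNth_self_removeNth i (v : Fin (n + 1 + 1) → ℂ), h0, hv]
        simp
      refine ⟨mk ⟨Fin.removeNth i (v : Fin (n + 1 + 1) → ℂ), hw⟩, ?_⟩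
      rw [hyperplaneEmb_mk]
      congr 1
      apply Subtype.ext
      rw [coe_padAt]
      conv_rhs => rw [← Fin.insertNth_self_removeNth i (v : Fin (n + 1 + 1) → ℂ), hv]

/-- The complement of the hyperplane `{z_i = 0}` is the source of the `i`-th affine chart.
[folklore] -/
theorem compl_range_hyperplaneEmb (i : Fin (n + 1 + 1)) :
    (range (hyperplaneEmb (n := n) i))ᶜ = (affineChart i).source := by
  rw [range_hyperplaneEmb, affineChart_source]
  ext p
  simp

/-- **The complement of the hyperplane is homeomorphic to `ℝ²⁽ⁿ⁺¹⁾`** (the affine chart).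
[folklore] -/
def complRangeHyperplaneEmbHomeomorph (i : Fin (n + 1 + 1)) :
    ↥(range (hyperplaneEmb (n := n) i))ᶜ ≃ₜ EuclideanSpace ℝ (Fin (2 * (n + 1))) :=
  (Homeomorph.setCongr (compl_range_hyperplaneEmb i)).trans
    ((affineChart i).toHomeomorphSourceTarget.trans
      ((Homeomorph.setCongr (affineChart_target i)).trans (Homeomorph.Set.univ _)))

/-- Hence the complement of the hyperplane is contractible. [folklore] -/
theorem contractibleSpace_compl_range_hyperplaneEmb (i : Fin (n + 1 + 1)) :
    ContractibleSpace ↥(range (hyperplaneEmb (n := n) i))ᶜ :=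
  (complRangeHyperplaneEmbHomeomorph i).contractibleSpace

/-- The homology of the complement of the hyperplane vanishes in positive degrees. [folklore] -/
theorem isZero_singularHomology_compl_range_hyperplaneEmb (R : Type) [CommRing R]
    (i : Fin (n + 1 + 1)) {j : ℕ} (hj : j ≠ 0) :
    Limits.IsZero (singularHomology R R ↥(range (hyperplaneEmb (n := n) i))ᶜ j) := by
  haveI := contractibleSpace_compl_range_hyperplaneEmb (n := n) i
  exact isZero_singularHomology_of_contractibleSpace R R hj

/-- **The hyperplane is taut in `ℂℙⁿ⁺¹`**: a retraction-neighbourhood datum for the compact,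
locally contractible subset `hyperplaneEmb i (ℂℙⁿ)` of the ENR `ℂℙⁿ⁺¹` (Spanier Thm. 6.1.10 with
Hatcher Thm. A.7; the tree's `Cech.RetractionNhds.nonempty_of_locallyContractibleSpace`).
[cite: HatcherAT2002, App. A Thm. A.7] -/
theorem nonempty_retractionNhds_range_hyperplaneEmb (i : Fin (n + 1 + 1)) :
    Nonempty (Cech.RetractionNhds (range (hyperplaneEmb (n := n) i))) := by
  obtain ⟨m, f, hf⟩ := Literature.Geometry.Manifold.exists_isClosedEmbedding_pi_of_compactSpace
    (M := ComplexProjectiveSpace (n + 1)) (EuclideanSpace ℝ (Fin (2 * (n + 1))))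
  have hNR : IsNeighbourhoodRetract (range f) :=
    isNeighbourhoodRetract_range_of_compactSpace
      isNeighbourhoodRetract_of_locallyContractibleSpace_holds (EuclideanSpace ℝ (Fin (2 * (n + 1))))
      hf.isEmbedding
  have hKc : IsCompact (range (hyperplaneEmb (n := n) i)) :=
    isCompact_range (continuous_hyperplaneEmb i)
  have hKl : LocallyContractibleSpace ↥(range (hyperplaneEmb (n := n) i)) :=
    locallyContractibleSpace_of_homeomorph (isClosedEmbedding_hyperplaneEmb i).isEmbedding.toHomeomorph
      (locallyContractibleSpace_of_chartedSpace (EuclideanSpace ℝ (Fin (2 * n)))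
        (M := ComplexProjectiveSpace n))
  exact Cech.RetractionNhds.nonempty_of_locallyContractibleSpace hf.isEmbedding hNR hKc hKl

/-! ### A complex orientation of `ℂℙⁿ` -/

/-- **A homological `ℤ`-orientation of `ℂℙⁿ` in dimension `2n`**: `ℂℙⁿ` is smoothly orientable
(holomorphic atlas, `isOrientable_complexProjectiveSpace_holds`) and a smooth orientation gives a
homological one (`isOrientableOver_int_of_isOrientable_holds`). [cite: MilnorStasheff1974, §14 and Appendix A] -/
def homologicalOrientationInt (n : ℕ) : HomologicalOrientation ℤ (ComplexProjectiveSpace n) (2 * n) :=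
  Classical.choice (isOrientableOver_int_of_isOrientable_holds (ComplexProjectiveSpace n)
    (isOrientable_complexProjectiveSpace_holds n))

/-- Its `R`-orientation `μₓ ↦ μₓ ⊗ 1` (Hatcher p. 235). [cite: HatcherAT2002, §3.3 p. 235] -/
def homologicalOrientation (R : Type) [CommRing R] (n : ℕ) :
    HomologicalOrientation R (ComplexProjectiveSpace n) (2 * n) :=
  (homologicalOrientationInt n).toCoeff R

/-! ### The restriction to the hyperplane is bijective in degrees `≤ 2n` -/

/-- **Restriction to the hyperplane is onto in degrees `k ≤ 2n`**: `Hᵏ(ℂℙⁿ⁺¹; R) → Hᵏ({z_i = 0}; R)`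
is surjective since `H_{2n+1-k}` of the contractible complement vanishes (`2n + 1 - k ≥ 1`),
Čech–Lefschetz duality (`singularCohomology.map_subtypeVal_surjective_of_isZero_compl`).
[cite: HatcherAT2002, Thm. 3.19 (proof, p. 250)] -/
theorem surjective_map_subtypeVal_range_hyperplaneEmb (R : Type) [CommRing R] (i : Fin (n + 1 + 1))
    {k : ℕ} (hk : k ≤ 2 * n) :
    Surjective (singularCohomology.map R R
      (⟨Subtype.val, continuous_subtype_val⟩ :
        C(↥(range (hyperplaneEmb (n := n) i)), ComplexProjectiveSpace (n + 1))) k) := by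
  obtain ⟨T⟩ := nonempty_retractionNhds_range_hyperplaneEmb (n := n) i
  exact singularCohomology.map_subtypeVal_surjective_of_isZero_compl (homologicalOrientation R (n + 1))
    (isClosedEmbedding_hyperplaneEmb i).isClosed_range T (p := k) (q := 2 * n + 2 - k)
    (q' := 2 * n + 1 - k) (by omega) (by omega)
    (isZero_singularHomology_compl_range_hyperplaneEmb R i (by omega))

/-- **Restriction to the hyperplane is injective in degrees `k ≤ 2n + 1`** (same duality,
`singularCohomology.map_subtypeVal_injective_of_isZero_compl`). [cite: HatcherAT2002, Thm. 3.19 (proof, p. 250)] -/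
theorem injective_map_subtypeVal_range_hyperplaneEmb (R : Type) [CommRing R] (i : Fin (n + 1 + 1))
    {k : ℕ} (hk : k ≤ 2 * n + 1) :
    Injective (singularCohomology.map R R
      (⟨Subtype.val, continuous_subtype_val⟩ :
        C(↥(range (hyperplaneEmb (n := n) i)), ComplexProjectiveSpace (n + 1))) k) := by
  obtain ⟨T⟩ := nonempty_retractionNhds_range_hyperplaneEmb (n := n) i
  exact singularCohomology.map_subtypeVal_injective_of_isZero_compl (homologicalOrientation R (n + 1))
    (isClosedEmbedding_hyperplaneEmb i).isClosed_range T (p := k) (q := 2 * n + 2 - k)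
    (by omega) (isZero_singularHomology_compl_range_hyperplaneEmb R i (by omega))

/-- The hyperplane embedding as a continuous map. [folklore] -/
def hyperplaneEmbC (i : Fin (n + 1 + 1)) : C(ComplexProjectiveSpace n, ComplexProjectiveSpace (n + 1)) :=
  ⟨hyperplaneEmb i, continuous_hyperplaneEmb i⟩

/-- **`(ℂℙⁿ ↪ ℂℙⁿ⁺¹)^* : Hᵏ(ℂℙⁿ⁺¹; R) → Hᵏ(ℂℙⁿ; R)` is bijective for `k ≤ 2n`** (Hatcher 2002, proof
of Thm. 3.19, p. 250: "the inclusion `ℂPⁿ⁻¹ ↪ ℂPⁿ` induces an isomorphism on `Hⁱ` for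
`i ≤ 2n − 2`"). [cite: HatcherAT2002, Thm. 3.19 (proof, p. 250)] -/
theorem bijective_map_hyperplaneEmb (R : Type) [CommRing R] (i : Fin (n + 1 + 1)) {k : ℕ}
    (hk : k ≤ 2 * n) :
    Bijective (singularCohomology.map R R (hyperplaneEmbC (n := n) i) k) := by
  have hemb := (isClosedEmbedding_hyperplaneEmb (n := n) i).isEmbedding
  have hfac : hyperplaneEmbC (n := n) i =
      (⟨Subtype.val, continuous_subtype_val⟩ :
        C(↥(range (hyperplaneEmb (n := n) i)), ComplexProjectiveSpace (n + 1))).comp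
        (hemb.toHomeomorph : C(ComplexProjectiveSpace n, ↥(range (hyperplaneEmb (n := n) i)))) := rfl
  rw [hfac, singularCohomology.map_comp]
  have hiso : Bijective (singularCohomology.map R R
      (hemb.toHomeomorph : C(ComplexProjectiveSpace n, ↥(range (hyperplaneEmb (n := n) i)))) k) :=
    ((forget (ModuleCat R)).mapIso (singularCohomology.mapIso R R hemb.toHomeomorph k)).toEquiv.bijective
  exact hiso.comp ⟨injective_map_subtypeVal_range_hyperplaneEmb R i (by omega),
    surjective_map_subtypeVal_range_hyperplaneEmb R i hk⟩

/-! ### Degree zero and the top degree -/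

/-- `ℂℙⁿ` is path connected (a connected manifold). [folklore] -/
theorem pathConnectedSpace (n : ℕ) : PathConnectedSpace (ComplexProjectiveSpace n) := by
  haveI := ChartedSpace.locallyPathConnectedSpace (EuclideanSpace ℝ (Fin (2 * n))) (ComplexProjectiveSpace n)
  exact pathConnectedSpace_iff_connectedSpace.mpr inferInstance

section DegreeZero

variable {K : Type} [Field K] {X : Type} [TopologicalSpace X] [PathConnectedSpace X]

/-- On a path-connected space `H⁰(X; K) ≃ K` sends `1` to `1`. [cite: HatcherAT2002, §3.1 p. 199] -/
theorem singularCohomologyZeroEquiv_one : singularCohomologyZeroEquiv K K X (singularCohomology.one K X) = 1 := by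
  rw [singularCohomology.one, singularCohomologyZeroEquiv_π, singularCochainComplex.cocyclesZeroEquiv_apply,
    singularCochainComplex.iCocycles_mk]
  rfl

/-- **`H⁰(X; K) = K · 1` for `X` path connected**: every degree-zero class is a multiple of the unit.
[cite: HatcherAT2002, §3.1 p. 199] -/
theorem exists_eq_smul_one (α : singularCohomology K K X 0) :
    ∃ a : K, α = a • singularCohomology.one K X := by
  refine ⟨singularCohomologyZeroEquiv K K X α, (singularCohomologyZeroEquiv K K X).injective ?_⟩
  rw [map_smul, singularCohomologyZeroEquiv_one, smul_eq_mul, mul_one]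

/-- `dim_K H⁰(X; K) = 1` for `X` path connected. [cite: HatcherAT2002, §3.1 p. 199] -/
theorem finrank_singularCohomology_zero : Module.finrank K (singularCohomology K K X 0) = 1 := by
  rw [(singularCohomologyZeroEquiv K K X).finrank_eq, Module.finrank_self]

/-- **A non-zero degree-zero class cups injectively**: `α ∈ H⁰ ∖ 0`, `β ≠ 0` ⇒ `α ⌣ β ≠ 0`
(`α = a · 1`, `1 ⌣ β = β`). [cite: HatcherAT2002, §3.2 p. 211] -/
theorem cupProduct_ne_zero_of_degree_zero_left {j m : ℕ} (h : 0 + j = m)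
    {α : singularCohomology K K X 0} {β : singularCohomology K K X j} (hα : α ≠ 0) (hβ : β ≠ 0) :
    cupProduct h α β ≠ 0 := by
  obtain rfl : m = j := by omega
  obtain ⟨a, rfl⟩ := exists_eq_smul_one α
  have ha : a ≠ 0 := by rintro rfl; exact hα (zero_smul _ _)
  rw [LinearMap.map_smul₂, one_cupProduct]
  exact smul_ne_zero ha hβ

/-- The same with the degree-zero class on the right (`α ⌣ 1 = α`). [cite: HatcherAT2002, §3.2 p. 211] -/
theorem cupProduct_ne_zero_of_degree_zero_right {i m : ℕ} (h : i + 0 = m)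
    {α : singularCohomology K K X i} {β : singularCohomology K K X 0} (hα : α ≠ 0) (hβ : β ≠ 0) :
    cupProduct h α β ≠ 0 := by
  obtain rfl : m = i := by omega
  obtain ⟨b, rfl⟩ := exists_eq_smul_one β
  have hb : b ≠ 0 := by rintro rfl; exact hβ (zero_smul _ _)
  rw [map_smul, cupProduct_one]
  exact smul_ne_zero hb hα

end DegreeZero

/-- **`dim_ℂ H²ⁿ(ℂℙⁿ; K) = 1`** for every field `K`: `ℂℙⁿ` is a closed connected `K`-oriented
`2n`-manifold (`nonempty_singularCohomology_top_equiv_holds`). [cite: HatcherAT2002, §3.3 Thm. 3.30] -/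
theorem finrank_singularCohomology_top (K : Type) [Field K] (n : ℕ) :
    Module.finrank K (singularCohomology K K (ComplexProjectiveSpace n) (2 * n)) = 1 := by
  obtain ⟨e⟩ := nonempty_singularCohomology_top_equiv_holds K (ComplexProjectiveSpace n) (2 * n)
    ⟨homologicalOrientation K n⟩
  rw [e.finrank_eq, Module.finrank_self]

/-! ### The induction: Betti numbers -/

/-- **`dim_K H²ᵏ(ℂℙᴺ; K) = 1` for `k ≤ N`** and every field `K` (Hatcher 2002, Thm. 3.19:
`H*(ℂPⁿ; ℤ) ≅ ℤ[α]/(αⁿ⁺¹)`, `|α| = 2`; by induction on `N`: below the top degree restrict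
bijectively to the hyperplane `ℂℙᴺ⁻¹`, in the top degree Poincaré duality).
[cite: HatcherAT2002, Thm. 3.19] [cite: MilnorStasheff1974, Thm. 14.4] -/
theorem finrank_singularCohomology_two_mul_eq_one (K : Type) [Field K] :
    ∀ (N k : ℕ), k ≤ N →
      Module.finrank K (singularCohomology K K (ComplexProjectiveSpace N) (2 * k)) = 1 := by
  intro N
  induction N with
  | zero =>
    intro k hk
    obtain rfl : k = 0 := by omega
    exact finrank_singularCohomology_top K 0
  | succ n ih =>
    intro k hk
    rcases Nat.lt_or_ge k (n + 1) with hlt | hge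
    · have hb : Bijective (singularCohomology.map K K (hyperplaneEmbC (n := n) 0) (2 * k)).hom :=
        bijective_map_hyperplaneEmb K 0 (by omega)
      rw [(LinearEquiv.ofBijective _ hb).finrank_eq]
      exact ih k (by omega)
    · obtain rfl : k = n + 1 := by omega
      exact finrank_singularCohomology_top K (n + 1)

/-- In particular `H²ᵏ(ℂℙᴺ; K)` is spanned by any of its non-zero elements (`k ≤ N`). [cite: HatcherAT2002, Thm. 3.19] -/
theorem exists_eq_smul_of_ne_zero (K : Type) [Field K] {N k : ℕ} (hk : k ≤ N)
    {β : singularCohomology K K (ComplexProjectiveSpace N) (2 * k)} (hβ : β ≠ 0)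
    (γ : singularCohomology K K (ComplexProjectiveSpace N) (2 * k)) : ∃ c : K, γ = c • β := by
  obtain ⟨c, hc⟩ := (finrank_eq_one_iff_of_nonzero' β hβ).1
    (finrank_singularCohomology_two_mul_eq_one K N k hk) γ
  exact ⟨c, hc.symm⟩

/-! ### The induction: the cup product -/

/-- **Non-degeneracy of the cup product on `H*(ℂℙᴺ; K)`**: for a field `K`, `p + q ≤ N` and
non-zero classes `α ∈ H²ᵖ(ℂℙᴺ; K)`, `β ∈ H^{2q}(ℂℙᴺ; K)`, the cup product `α ⌣ β ∈ H^{2(p+q)}` is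
non-zero — equivalently (all these groups being lines) `H*(ℂℙᴺ; K) = K[h]/(h^{N+1})` for any
generator `h` of `H²` (Hatcher 2002, Thm. 3.19; Milnor–Stasheff Thm. 14.4). Hatcher's induction
(p. 250): for `p + q < N` restrict to the hyperplane `ℂℙᴺ⁻¹` (bijective in degrees `≤ 2N − 2`,
multiplicative), for `p + q = N` the cup product pairing `H²ᵖ × H^{2q} → H²ᴺ → K` is perfect
(Prop. 3.38 over a field, the tree's `isPerfPair_cupPairing_of_field_holds`) and `H^{2q}` is a
line. [cite: HatcherAT2002, Thm. 3.19 and Prop. 3.38] [cite: MilnorStasheff1974, Thm. 14.4] -/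
theorem cupProduct_ne_zero_of_add_le (K : Type) [Field K] :
    ∀ (N : ℕ) {p q m : ℕ} (hm : 2 * p + 2 * q = m), p + q ≤ N →
      ∀ {α : singularCohomology K K (ComplexProjectiveSpace N) (2 * p)}
        {β : singularCohomology K K (ComplexProjectiveSpace N) (2 * q)},
        α ≠ 0 → β ≠ 0 → cupProduct hm α β ≠ 0 := by
  intro N
  induction N with
  | zero =>
    intro p q m hm hpq α β hα hβ
    obtain rfl : p = 0 := by omega
    obtain rfl : q = 0 := by omega
    haveI := pathConnectedSpace 0
    exact cupProduct_ne_zero_of_degree_zero_left (X := ComplexProjectiveSpace 0) hm hα hβ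
  | succ n ih =>
    intro p q m hm hpq α β hα hβ
    rcases Nat.lt_or_ge (p + q) (n + 1) with hlt | hge
    · -- restrict to the hyperplane, bijectively in degrees `2p, 2q, 2(p+q) ≤ 2n`
      intro h0
      have e := cupProduct_map (R := K) (hyperplaneEmbC (n := n) 0) hm α β
      rw [h0, map_zero] at e
      exact ih hm (by omega)
        (fun h => hα ((bijective_map_hyperplaneEmb K 0 (by omega)).1 (by rw [h, map_zero])))
        (fun h => hβ ((bijective_map_hyperplaneEmb K 0 (by omega)).1 (by rw [h, map_zero])))
        e.symm
    · -- `p + q = n + 1`: Poincaré duality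
      have hpq' : p + q = n + 1 := by omega
      haveI := pathConnectedSpace (n + 1)
      rcases Nat.eq_zero_or_pos p with rfl | hp
      · exact cupProduct_ne_zero_of_degree_zero_left (X := ComplexProjectiveSpace (n + 1)) hm hα hβ
      rcases Nat.eq_zero_or_pos q with rfl | hq
      · exact cupProduct_ne_zero_of_degree_zero_right (X := ComplexProjectiveSpace (n + 1)) hm hα hβ
      have hmn : 2 * p + 2 * q = 2 * (n + 1) := by omega
      obtain rfl : m = 2 * (n + 1) := by omega
      haveI : (cupPairing (homologicalOrientation K (n + 1)) hm).IsPerfPair :=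
        isPerfPair_cupPairing_of_field_holds
      have hinj : Injective (cupPairing (homologicalOrientation K (n + 1)) hm) :=
        (LinearMap.IsPerfPair.bijective_left (cupPairing (homologicalOrientation K (n + 1)) hm)).1
      -- some `β₀` pairs non-trivially with `α`
      have hne : cupPairing (homologicalOrientation K (n + 1)) hm α ≠ 0 := fun h =>
        hα (hinj (by rw [h, map_zero]))
      obtain ⟨β₀, hβ₀⟩ : ∃ β₀, cupPairing (homologicalOrientation K (n + 1)) hm α β₀ ≠ 0 := by
        by_contra hcon
        push Not at hcon
        exact hne (LinearMap.ext hcon)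
      -- `β₀ = c • β` on the line `H^{2q}`
      obtain ⟨c, rfl⟩ := exists_eq_smul_of_ne_zero K (N := n + 1) (k := q) (by omega) hβ β₀
      intro h0
      apply hβ₀
      rw [map_smul, cupPairing_apply, h0, map_zero, LinearMap.zero_apply, smul_zero]

end ComplexProjectiveSpace

end Literature.Topology.FourManifolds

end
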